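import Summits.QuantumAdvantage.QuantumAdvantage.Theorems.LinnikCubicClassGroupsDegreeOnePrimesEscapeConjClassTheta
import Summits.QuantumAdvantage.QuantumAdvantage.Theorems.LinnikCubicClassGroupsDegreeOnePrimesEscapeHeckeConjugateIndex
import Literature.NumberTheory.LFunctions.GRHPrimeIdealCountLowerBound
import HarnessLib

/-!
# Preliminaries for the Chebotarev prime number theorem for conjugacy classes in the Linnik range

Topic `Summits/QuantumAdvantage/QuantumAdvantage/Theorems`, cell B2b-1 (linnik-cubic), PART A (gen 13); helper
toward the crux `DegreeOnePrimesEscape` (stmt-QuantumAdvantage-11543) — step B6 of the LMO programme.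
HONEST FRAMING: the value of this file is a THEOREM (kernel-checked) — NOT summit progress.

* `classJunk_le` — the junk of Deuring's reduction (`…ConjClassTheta.lean`) is `≤ 40 [N:ℚ] x^{3/4}` once
  `|d_N| ≤ x^{1/8}`;
* `character_pow_eq_neg_one` — for a faithful character `χ₁` of a finite group and `τ` of order `m`,
  `(χ₁(τ)^j)² = 1` with `0 < j < m` forces `χ₁(τ)^j = −1` (the sign of the exceptional term at a generator).

References: [LagariasMontgomeryOdlyzko1979, §§3, 9].
-/

noncomputable section

open scoped NumberField nonZeroDivisors Classical
open Finset Real Ideal NumberField IsDedekindDomain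
open Literature.NumberTheory.NumberFields Literature.NumberTheory.LFunctions
  Literature.NumberTheory.LFunctions.NumberField Literature.NumberTheory.GaloisRepresentations

namespace Summit.QuantumAdvantage.QuantumAdvantage.Theorems.DegreeOnePrimesEscape

variable {N : Type} [Field N] [NumberField N] [IsGalois ℚ N]

/-- **The junk of Deuring's reduction is `≤ 40 n x^{3/4}`** once `|d_N| ≤ x^{1/8}`:
`m((ψ_E − θ_E)(x) + [E:ℚ](√x + 1) log x + [E:ℚ] ω(d_N) log|d_N|) ≤ 40 [N:ℚ] x^{3/4}` (`m [E:ℚ] = [N:ℚ]`). -/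
theorem classJunk_le (E : IntermediateField ℚ N) {x : ℝ} (hx : 1 < x)
    (hdx : ((NumberField.discr N).natAbs : ℝ) ≤ x ^ (1 / 8 : ℝ)) :
    (Nat.card (N ≃ₐ[E] N) : ℝ) * ((chebyshevPsiIdeal E x - chebyshevThetaIdeal E x) +
        Module.finrank ℚ E * (Real.sqrt x + 1) * Real.log x +
        Module.finrank ℚ E * ((NumberField.discr N).natAbs.primeFactors.card) *
          Real.log ((NumberField.discr N).natAbs : ℝ)) ≤
      40 * Module.finrank ℚ N * x ^ (3 / 4 : ℝ) := by
  haveI : FiniteDimensional E N := Module.Finite.of_restrictScalars_finite ℚ E N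
  have hx0 : 0 < x := by linarith
  have hx1 : 1 ≤ x := hx.le
  set m : ℕ := Module.finrank E N with hm
  have hcard : Nat.card (N ≃ₐ[E] N) = m := IsGalois.card_aut_eq_finrank E N
  set nE : ℝ := (Module.finrank ℚ E : ℝ) with hnE
  set nN : ℝ := (Module.finrank ℚ N : ℝ) with hnN
  have hdeg : (m : ℝ) * nE = nN := by
    rw [hnE, hnN, ← Module.finrank_mul_finrank ℚ E N, hm]; push_cast; ring
  have hm0 : (0 : ℝ) ≤ m := Nat.cast_nonneg _
  have hnE0 : 0 ≤ nE := Nat.cast_nonneg _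
  have hnN0 : 0 ≤ nN := Nat.cast_nonneg _
  rw [hcard]
  -- elementary functions of `x`
  have hlog0 : 0 < Real.log x := Real.log_pos hx
  have hlog8 : Real.log x ≤ 8 * x ^ (1 / 8 : ℝ) := by
    have := Real.log_le_rpow_div hx0.le (by norm_num : (0 : ℝ) < 1 / 8)
    linarith
  have hsqrt : Real.sqrt x = x ^ (1 / 2 : ℝ) := Real.sqrt_eq_rpow x
  have hsqrt1 : 1 ≤ Real.sqrt x := by rw [← Real.sqrt_one]; exact Real.sqrt_le_sqrt hx1
  have h18 : 0 ≤ x ^ (1 / 8 : ℝ) := Real.rpow_nonneg hx0.le _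
  have h58 : x ^ (1 / 2 : ℝ) * x ^ (1 / 8 : ℝ) ≤ x ^ (3 / 4 : ℝ) := by
    rw [← Real.rpow_add hx0]; exact Real.rpow_le_rpow_of_exponent_le hx1 (by norm_num)
  have h14 : x ^ (1 / 8 : ℝ) * x ^ (1 / 8 : ℝ) ≤ x ^ (3 / 4 : ℝ) := by
    rw [← Real.rpow_add hx0]; exact Real.rpow_le_rpow_of_exponent_le hx1 (by norm_num)
  have h34 : 0 ≤ x ^ (3 / 4 : ℝ) := Real.rpow_nonneg hx0.le _
  -- `√x log x ≤ 8 x^{3/4}`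
  have hsl : Real.sqrt x * Real.log x ≤ 8 * x ^ (3 / 4 : ℝ) := by
    rw [hsqrt]
    calc x ^ (1 / 2 : ℝ) * Real.log x ≤ x ^ (1 / 2 : ℝ) * (8 * x ^ (1 / 8 : ℝ)) :=
          mul_le_mul_of_nonneg_left hlog8 (Real.rpow_nonneg hx0.le _)
      _ = 8 * (x ^ (1 / 2 : ℝ) * x ^ (1 / 8 : ℝ)) := by ring
      _ ≤ 8 * x ^ (3 / 4 : ℝ) := by nlinarith
  -- (1) the prime powers
  have h1 : chebyshevPsiIdeal E x - chebyshevThetaIdeal E x ≤ nE * (2 * Real.sqrt x * Real.log x) := by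
    refine (chebyshevPsiIdeal_sub_chebyshevThetaIdeal_le E hx1).trans ?_
    have h := primeIdealCount_le_two_mul_finrank_mul E (Real.sqrt_nonneg x)
    calc (primeIdealCount E (Real.sqrt x) : ℝ) * Real.log x ≤ (2 * nE * Real.sqrt x) * Real.log x :=
          mul_le_mul_of_nonneg_right h hlog0.le
      _ = nE * (2 * Real.sqrt x * Real.log x) := by ring
  -- (2) the primes of degree `≥ 2`
  have h2 : (Real.sqrt x + 1) * Real.log x ≤ 2 * Real.sqrt x * Real.log x := by nlinarith
  -- (3) the primes above `d_N`: `ω(d) log d ≤ d log d ≤ x^{1/8} x^{1/8}`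
  set d : ℝ := ((NumberField.discr N).natAbs : ℝ) with hd
  have hd1 : 1 ≤ d := by
    rw [hd]; exact_mod_cast Nat.pos_of_ne_zero (Int.natAbs_ne_zero.mpr (NumberField.discr_ne_zero N))
  have hω : (((NumberField.discr N).natAbs.primeFactors.card : ℕ) : ℝ) ≤ d := by
    have h1 : (NumberField.discr N).natAbs.primeFactors.card ≤ (NumberField.discr N).natAbs := by
      calc (NumberField.discr N).natAbs.primeFactors.card ≤ (Finset.Icc 1 (NumberField.discr N).natAbs).card :=
            Finset.card_le_card fun p hp ↦ Finset.mem_Icc.mpr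
              ⟨(Nat.prime_of_mem_primeFactors hp).one_lt.le, Nat.le_of_mem_primeFactors hp⟩
        _ = (NumberField.discr N).natAbs := by simp
    rw [hd]; exact_mod_cast h1
  have hlogd : Real.log d ≤ x ^ (1 / 8 : ℝ) := by
    have h1 : Real.log d ≤ Real.log (x ^ (1 / 8 : ℝ)) := Real.log_le_log (by linarith) hdx
    rw [Real.log_rpow hx0] at h1
    nlinarith
  have hlogd0 : 0 ≤ Real.log d := Real.log_nonneg hd1
  have h3 : (((NumberField.discr N).natAbs.primeFactors.card : ℕ) : ℝ) * Real.log d ≤ x ^ (3 / 4 : ℝ) := by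
    calc (((NumberField.discr N).natAbs.primeFactors.card : ℕ) : ℝ) * Real.log d ≤ d * Real.log d :=
          mul_le_mul_of_nonneg_right hω hlogd0
      _ ≤ x ^ (1 / 8 : ℝ) * x ^ (1 / 8 : ℝ) := mul_le_mul hdx hlogd hlogd0 h18
      _ ≤ x ^ (3 / 4 : ℝ) := h14
  -- assemble
  have hsum : (chebyshevPsiIdeal E x - chebyshevThetaIdeal E x) + nE * (Real.sqrt x + 1) * Real.log x +
      nE * ((NumberField.discr N).natAbs.primeFactors.card) * Real.log d ≤ nE * (33 * x ^ (3 / 4 : ℝ)) := by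
    have e1 : nE * (2 * Real.sqrt x * Real.log x) ≤ nE * (16 * x ^ (3 / 4 : ℝ)) :=
      mul_le_mul_of_nonneg_left (by nlinarith) hnE0
    have e2 : nE * (Real.sqrt x + 1) * Real.log x ≤ nE * (16 * x ^ (3 / 4 : ℝ)) := by
      rw [mul_assoc]; exact mul_le_mul_of_nonneg_left (h2.trans (by nlinarith)) hnE0
    have e3 : nE * ((NumberField.discr N).natAbs.primeFactors.card) * Real.log d ≤ nE * x ^ (3 / 4 : ℝ) := by
      rw [mul_assoc]; exact mul_le_mul_of_nonneg_left h3 hnE0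
    linarith
  calc (m : ℝ) * ((chebyshevPsiIdeal E x - chebyshevThetaIdeal E x) + nE * (Real.sqrt x + 1) * Real.log x +
        nE * ((NumberField.discr N).natAbs.primeFactors.card) * Real.log d)
      ≤ m * (nE * (33 * x ^ (3 / 4 : ℝ))) := mul_le_mul_of_nonneg_left hsum hm0
    _ = 33 * nN * x ^ (3 / 4 : ℝ) := by rw [← hdeg]; ring
    _ ≤ 40 * nN * x ^ (3 / 4 : ℝ) := by nlinarith [mul_nonneg hnN0 h34]

/-- In a cyclic group of order `m` generated by `τ`, a faithful character takes `τ` to an element whose `j`-th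
power is `−1` as soon as `(χ₁(τ)^j)² = 1` and `0 < j < m`. -/
theorem character_pow_eq_neg_one {G : Type*} [Group G] [Finite G] (χ₁ : G →* ℂˣ) (hχ₁ : Function.Injective χ₁)
    (τ : G) {m j : ℕ} (horder : orderOf τ = m) (hj0 : 0 < j) (hjm : j < m)
    (hsq : (((χ₁ τ : ℂˣ) : ℂ) ^ j) ^ 2 = 1) : ((χ₁ τ : ℂˣ) : ℂ) ^ j = -1 := by
  rcases pow_eq_one_or_neg_one_of_sq hsq with h | h
  · exfalso
    have hu : χ₁ (τ ^ j) = 1 := by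
      apply Units.val_eq_one.mp
      rw [map_pow, Units.val_pow_eq_pow_val, h]
    have hτ : τ ^ j = 1 := hχ₁ (by rw [hu, map_one])
    exact pow_ne_one_of_lt_orderOf hj0.ne' (by rw [horder]; exact hjm) hτ
  · exact h

end Summit.QuantumAdvantage.QuantumAdvantage.Theorems.DegreeOnePrimesEscape

end
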